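import Summits.AtomisticToContinuum.Crystallization.Theorems.PhononSlackCertificatesPeriodicGivenLayeredClosing5

/-!
# Vertical pinning, part 5: the window bookkeeping of a single shifted gap

Helper for the registered stub `stub_verticalPinning` (T4b-iv) of line `Sketch` of the crux
`GappedShellCensus.CleanLimitsHaveWindows` (stmt-AtomisticToContinuum-15932).

Let `T_m(ζ) = Σ'_{m' ≠ m} Φ(ζ m' − ζ m, L m' − L m)` be the registry energy of layer `m` of an exactly layered
set with heights `ζ` (`Φ(H, δ) = layerInteraction V_LJ b H δ 1`, `L = haggLabel s`), and let `ζ'` be `ζ` with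
the layers above the gap `g` moved by `θ` (`vpShift`). Only the pairs of layers straddling `g` change. If
the change `Φ(H, δ) − Φ(H + θ, δ)` of a straddling pair at layer distance `k` is at least `w k`, where
`w k = λ k` for `k ≤ 5` and `w k = −μ k⁻⁵` beyond (`vpW`), then on every window `[m₁, m₁ + n)` containing the
layers `g − 4, …, g + 5`

  `2 (Σ_{k ≤ 5} k λ_k) − 2 μ Z ≤ Σ_{m ∈ [m₁, m₁+n)} (T_m(ζ) − T_m(ζ'))`,  `Z = (6/625 + 1/375)/4`

(`vp_single_gap`): each near pair at distance `k ≤ 5` occurs with both orientations (`k` pairs per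
distance), and the far pairs are summed by the tails `Σ_{n ≥ 0} (D+n)⁻⁵ ≤ (D−1)⁻⁴/4`,
`Σ_{i ≥ 6} i⁻⁴ ≤ 1/375`. [folklore]
-/

noncomputable section

namespace Summit.AtomisticToContinuum.Crystallization.Theorems.CleanHull

open scoped BigOperators
open Finset Filter Literature.MathematicalPhysics.StatisticalMechanics

/-! ## Elementary tails -/

/-- `x⁻⁵ ≤ ((x−1)⁻⁴ − x⁻⁴)/4` for `x ≥ 2`. [folklore] -/
theorem vp_inv_pow_five_le (x : ℝ) (hx : 2 ≤ x) :
    (x⁻¹) ^ 5 ≤ 1 / 4 * (((x - 1)⁻¹) ^ 4 - (x⁻¹) ^ 4) := by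
  have hx0 : 0 < x := by linarith
  have hx1 : 0 < x - 1 := by linarith
  rw [inv_pow, inv_pow, inv_pow, inv_eq_one_div, inv_eq_one_div, inv_eq_one_div,
    div_sub_div _ _ (by positivity) (by positivity), div_mul_eq_mul_div, one_mul, div_div,
    div_le_div_iff₀ (by positivity) (by positivity)]
  nlinarith [mul_pos hx1 hx1, mul_pos hx0 hx1, mul_pos hx0 hx0, pow_pos hx1 3, pow_pos hx0 3,
    mul_pos (pow_pos hx1 2) (pow_pos hx0 2)]

/-- `x⁻⁴ ≤ ((x−1)⁻³ − x⁻³)/3` for `x ≥ 2`. [folklore] -/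
theorem vp_inv_pow_four_le (x : ℝ) (hx : 2 ≤ x) :
    (x⁻¹) ^ 4 ≤ 1 / 3 * (((x - 1)⁻¹) ^ 3 - (x⁻¹) ^ 3) := by
  have hx0 : 0 < x := by linarith
  have hx1 : 0 < x - 1 := by linarith
  rw [inv_pow, inv_pow, inv_pow, inv_eq_one_div, inv_eq_one_div, inv_eq_one_div,
    div_sub_div _ _ (by positivity) (by positivity), div_mul_eq_mul_div, one_mul, div_div,
    div_le_div_iff₀ (by positivity) (by positivity)]
  nlinarith [mul_pos hx1 hx1, mul_pos hx0 hx1, mul_pos hx0 hx0, pow_pos hx1 3, pow_pos hx0 3]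

/-- Partial sums: `Σ_{n<N} (D+n)⁻⁵ ≤ ((D−1)⁻⁴ − (D+N−1)⁻⁴)/4` for `D ≥ 2`. [folklore] -/
theorem vp_sum_inv_pow_five_le (D : ℝ) (hD : 2 ≤ D) (N : ℕ) :
    ∑ n ∈ Finset.range N, ((D + n)⁻¹) ^ 5 ≤ 1 / 4 * (((D - 1)⁻¹) ^ 4 - ((D + N - 1)⁻¹) ^ 4) := by
  induction N with
  | zero => simp
  | succ N ih =>
    rw [Finset.sum_range_succ]
    have h := vp_inv_pow_five_le (D + N) (by have : (0 : ℝ) ≤ N := Nat.cast_nonneg N; linarith)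
    push_cast
    rw [show D + ((N : ℝ) + 1) - 1 = D + N by ring]
    linarith

/-- The fifth-power tail: `Σ_{n ≥ 0} (D+n)⁻⁵ ≤ (D−1)⁻⁴/4` for `D ≥ 2` (with summability). [folklore] -/
theorem vp_tsum_inv_pow_five_le (D : ℝ) (hD : 2 ≤ D) :
    (Summable fun n : ℕ => ((D + n)⁻¹) ^ 5) ∧ ∑' n : ℕ, ((D + n)⁻¹) ^ 5 ≤ 1 / 4 * ((D - 1)⁻¹) ^ 4 := by
  have h0 : ∀ n : ℕ, 0 ≤ ((D + n)⁻¹) ^ 5 := fun n => by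
    have : (0 : ℝ) ≤ n := Nat.cast_nonneg n
    have : 0 < D + n := by linarith
    positivity
  have hb : ∀ N : ℕ, ∑ n ∈ Finset.range N, ((D + n)⁻¹) ^ 5 ≤ 1 / 4 * ((D - 1)⁻¹) ^ 4 := by
    intro N
    have := vp_sum_inv_pow_five_le D hD N
    have hpos : 0 ≤ ((D + N - 1)⁻¹) ^ 4 := by
      have : (0 : ℝ) ≤ N := Nat.cast_nonneg N
      have : 0 < D + N - 1 := by linarith
      positivity
    linarith
  exact ⟨summable_of_sum_range_le h0 hb, Real.tsum_le_of_sum_range_le h0 hb⟩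

/-- `Σ_{j<J} (6+j)⁻⁴ ≤ 1/375`. [folklore] -/
theorem vp_sum_inv_pow_four_le (J : ℕ) : ∑ j ∈ Finset.range J, (((6 : ℝ) + j)⁻¹) ^ 4 ≤ 1 / 375 := by
  have hstrong : ∀ J : ℕ, ∑ j ∈ Finset.range J, (((6 : ℝ) + j)⁻¹) ^ 4 ≤
      1 / 3 * (((5 : ℝ))⁻¹ ^ 3 - (((6 : ℝ) + J - 1)⁻¹) ^ 3) := by
    intro J
    induction J with
    | zero => norm_num
    | succ J ih =>
      rw [Finset.sum_range_succ]
      have h := vp_inv_pow_four_le ((6 : ℝ) + J) (by have : (0 : ℝ) ≤ J := Nat.cast_nonneg J; linarith)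
      push_cast
      rw [show (6 : ℝ) + ((J : ℝ) + 1) - 1 = 6 + J by ring]
      rw [show (6 : ℝ) + J - 1 = 5 + J by ring] at ih
      rw [show (6 : ℝ) + J - 1 = 5 + J by ring] at h
      linarith
  refine (hstrong J).trans ?_
  have hpos : 0 ≤ (((6 : ℝ) + J - 1)⁻¹) ^ 3 := by
    have : (0 : ℝ) ≤ J := Nat.cast_nonneg J
    have : (0 : ℝ) < 6 + J - 1 := by linarith
    positivity
  have h5 : ((5 : ℝ))⁻¹ ^ 3 = 1 / 125 := by norm_num
  rw [h5]
  linarith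

/-! ## The pair weights -/

/-- The pair weight at layer distance `k`: the certified near constant `λ k` for `k ≤ 5`, the far bound
`−μ k⁻⁵` beyond. [folklore] -/
def vpW (lam : ℕ → ℝ) (μ : ℝ) (k : ℕ) : ℝ := if k ≤ 5 then lam k else -(μ * ((k : ℝ)⁻¹) ^ 5)

/-- Beyond distance five the weights are the far bound. [folklore] -/
theorem vpW_far (lam : ℕ → ℝ) (μ : ℝ) (i n : ℕ) :
    vpW lam μ (i + 1 + (n + (5 - i))) = -(μ * ((((max i 5 : ℕ) : ℝ) + 1 + n)⁻¹) ^ 5) := by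
  have e : i + 1 + (n + (5 - i)) = max i 5 + 1 + n := by omega
  unfold vpW
  rw [if_neg (by omega), e, Nat.cast_add, Nat.cast_add, Nat.cast_one]

/-- The weights along a ray are summable. [folklore] -/
theorem vp_summable_W (lam : ℕ → ℝ) (μ : ℝ) (i : ℕ) : Summable fun n : ℕ => vpW lam μ (i + 1 + n) := by
  have h := (vp_tsum_inv_pow_five_le (((max i 5 : ℕ) : ℝ) + 1) (by
    have : (5 : ℝ) ≤ ((max i 5 : ℕ) : ℝ) := by exact_mod_cast le_max_right i 5
    linarith)).1
  have h2 : Summable fun n : ℕ => vpW lam μ (i + 1 + (n + (5 - i))) := by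
    simp only [vpW_far]
    exact (h.mul_left μ).neg
  exact (summable_nat_add_iff (5 - i)).1 h2

/-- **Near rays** (`i < 5`): `Σ_n w(i+1+n) ≥ Σ_{n < 5−i} λ(i+1+n) − μ/2500`. [folklore] -/
theorem vp_tsum_W_near (lam : ℕ → ℝ) {μ : ℝ} (hμ : 0 ≤ μ) (i : ℕ) (hi : i < 5) :
    ∑ n ∈ Finset.range (5 - i), lam (i + 1 + n) - μ / 2500 ≤ ∑' n : ℕ, vpW lam μ (i + 1 + n) := by
  rw [← (vp_summable_W lam μ i).sum_add_tsum_nat_add (5 - i)]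
  have hnear : ∑ n ∈ Finset.range (5 - i), vpW lam μ (i + 1 + n) =
      ∑ n ∈ Finset.range (5 - i), lam (i + 1 + n) :=
    Finset.sum_congr rfl fun n hn => by
      unfold vpW; rw [if_pos (by have := Finset.mem_range.1 hn; omega)]
  rw [hnear]
  simp only [vpW_far, show max i 5 = 5 from max_eq_right hi.le]
  obtain ⟨hs, hle⟩ := vp_tsum_inv_pow_five_le (((5 : ℕ) : ℝ) + 1) (by norm_num)
  rw [tsum_neg, tsum_mul_left]
  norm_num at hle ⊢
  nlinarith

/-- **Far rays** (`i ≥ 5`): `Σ_n w(i+1+n) ≥ −(μ/4) i⁻⁴`. [folklore] -/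
theorem vp_tsum_W_far (lam : ℕ → ℝ) {μ : ℝ} (hμ : 0 ≤ μ) (i : ℕ) (hi : 5 ≤ i) :
    -(μ / 4 * ((i : ℝ)⁻¹) ^ 4) ≤ ∑' n : ℕ, vpW lam μ (i + 1 + n) := by
  have h5 : 5 - i = 0 := by omega
  have e : (fun n : ℕ => vpW lam μ (i + 1 + n)) =
      fun n : ℕ => -(μ * ((((max i 5 : ℕ) : ℝ) + 1 + n)⁻¹) ^ 5) := by
    funext n
    have := vpW_far lam μ i n
    rwa [h5, add_zero] at this
  rw [e, show max i 5 = i from max_eq_left hi, tsum_neg, tsum_mul_left]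
  have hi' : (5 : ℝ) ≤ i := by exact_mod_cast hi
  obtain ⟨-, hle⟩ := vp_tsum_inv_pow_five_le ((i : ℝ) + 1) (by linarith)
  rw [show (i : ℝ) + 1 - 1 = i by ring] at hle
  nlinarith

/-- The double count of the near pairs: `Σ_{i<5} Σ_{n<5−i} λ(i+1+n) = Σ_{k<6} k λ_k`. [folklore] -/
theorem vp_near_count (lam : ℕ → ℝ) :
    ∑ i ∈ Finset.range 5, ∑ n ∈ Finset.range (5 - i), lam (i + 1 + n) =
      ∑ k ∈ Finset.range 6, (k : ℝ) * lam k := by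
  simp only [Finset.sum_range_succ, Finset.sum_range_zero]
  norm_num
  ring

/-- **The arithmetic of one orientation**: for `I ≥ 5` rays,
`Σ_{k<6} k λ_k − μ Z ≤ Σ_{i<I} Σ_n w(i+1+n)`, `Z = (6/625 + 1/375)/4`. [folklore] -/
theorem vp_arith (lam : ℕ → ℝ) {μ : ℝ} (hμ : 0 ≤ μ) (I : ℕ) (hI : 5 ≤ I) :
    ∑ k ∈ Finset.range 6, (k : ℝ) * lam k - μ * (1 / 4 * (6 / 625 + 1 / 375)) ≤
      ∑ i ∈ Finset.range I, ∑' n : ℕ, vpW lam μ (i + 1 + n) := by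
  obtain ⟨J, rfl⟩ : ∃ J, I = 5 + J := ⟨I - 5, by omega⟩
  rw [Finset.sum_range_add, ← vp_near_count]
  -- near rays
  have hnear : ∑ i ∈ Finset.range 5, ∑ n ∈ Finset.range (5 - i), lam (i + 1 + n) - 5 * (μ / 2500) ≤
      ∑ i ∈ Finset.range 5, ∑' n : ℕ, vpW lam μ (i + 1 + n) := by
    have := Finset.sum_le_sum fun i hi => vp_tsum_W_near lam hμ i (Finset.mem_range.1 hi)
    rw [Finset.sum_sub_distrib, Finset.sum_const, Finset.card_range, nsmul_eq_mul] at this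
    push_cast at this
    linarith
  -- far rays
  have hfar : -(μ / 4 * (1 / 625 + 1 / 375)) ≤ ∑ j ∈ Finset.range J, ∑' n : ℕ, vpW lam μ (5 + j + 1 + n) := by
    have h1 := Finset.sum_le_sum fun j (_ : j ∈ Finset.range J) =>
      vp_tsum_W_far lam hμ (5 + j) (Nat.le_add_right 5 j)
    refine le_trans ?_ h1
    have h2 : ∑ j ∈ Finset.range J, (((5 + j : ℕ) : ℝ)⁻¹) ^ 4 ≤ 1 / 625 + 1 / 375 := by
      rcases J with _ | J
      · norm_num
      · rw [Finset.sum_range_succ']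
        have := vp_sum_inv_pow_four_le J
        have e : ∑ j ∈ Finset.range J, (((5 + (j + 1) : ℕ) : ℝ)⁻¹) ^ 4 =
            ∑ j ∈ Finset.range J, (((6 : ℝ) + j)⁻¹) ^ 4 :=
          Finset.sum_congr rfl fun j _ => by push_cast; ring_nf
        have h0 : (((5 + 0 : ℕ) : ℝ)⁻¹) ^ 4 = 1 / 625 := by norm_num
        rw [e, h0]
        linarith
    rw [Finset.sum_neg_distrib, neg_le_neg_iff, ← Finset.mul_sum]
    exact mul_le_mul_of_nonneg_left h2 (by positivity)
  linarith

/-! ## The registry energies and the shifted profile -/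

/-- The registry energy of layer `m`: `Σ'_{m' ≠ m} Φ(ζ m' − ζ m, L m' − L m)`. [folklore] -/
def vpT (b : ℝ) (s : ℤ → ℤ) (ζ : ℤ → ℝ) (m : ℤ) : ℝ :=
  ∑' m' : ℤ, if m' = m then (0 : ℝ) else
    layerInteraction lennardJones b (ζ m' - ζ m) (haggLabel s m' - haggLabel s m) 1

/-- The profile with the layers above the gap `g` moved by `θ`. [folklore] -/
def vpShift (ζ : ℤ → ℝ) (g : ℤ) (θ : ℝ) (m : ℤ) : ℝ := ζ m + if g < m then θ else 0

/-- Height differences of the shifted profile. [folklore] -/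
theorem vpShift_sub (ζ : ℤ → ℝ) (g : ℤ) (θ : ℝ) (m m' : ℤ) :
    vpShift ζ g θ m' - vpShift ζ g θ m =
      ζ m' - ζ m + ((if g < m' then θ else 0) - (if g < m then θ else 0)) := by
  unfold vpShift; ring

/-- **Orientation one.** For `m ≤ g`, the change of the registry energy of layer `m` is the ray sum over
the layers `m' = g + 1 + n` above the gap, bounded below by the weights. [folklore] -/
theorem vp_ray_below (b : ℝ) (s : ℤ → ℤ) (ζ : ℤ → ℝ) (g : ℤ) (θ : ℝ) (lam : ℕ → ℝ) (μ : ℝ)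
    (hsum : ∀ m : ℤ, Summable fun m' : ℤ => if m' = m then (0 : ℝ) else
      layerInteraction lennardJones b (ζ m' - ζ m) (haggLabel s m' - haggLabel s m) 1)
    (hsum' : ∀ m : ℤ, Summable fun m' : ℤ => if m' = m then (0 : ℝ) else
      layerInteraction lennardJones b (vpShift ζ g θ m' - vpShift ζ g θ m) (haggLabel s m' - haggLabel s m) 1)
    (hpair : ∀ m m' : ℤ, m ≤ g → g < m' → vpW lam μ (m' - m).toNat ≤
      layerInteraction lennardJones b (ζ m' - ζ m) (haggLabel s m' - haggLabel s m) 1 -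
        layerInteraction lennardJones b (ζ m' - ζ m + θ) (haggLabel s m' - haggLabel s m) 1)
    (m : ℤ) (hm : m ≤ g) :
    ∑' n : ℕ, vpW lam μ ((g - m).toNat + 1 + n) ≤ vpT b s ζ m - vpT b s (vpShift ζ g θ) m := by
  unfold vpT
  rw [← (hsum m).tsum_sub (hsum' m)]
  set d : ℤ → ℝ := fun m' => (if m' = m then (0 : ℝ) else
      layerInteraction lennardJones b (ζ m' - ζ m) (haggLabel s m' - haggLabel s m) 1) -
    (if m' = m then (0 : ℝ) else
      layerInteraction lennardJones b (vpShift ζ g θ m' - vpShift ζ g θ m) (haggLabel s m' - haggLabel s m) 1)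
    with hd
  have hds : Summable d := (hsum m).sub (hsum' m)
  rw [LayeredHull.clo_tsum_int_split d (g + 1) hds]
  -- below the gap nothing changes
  have hzero : ∀ n : ℕ, d (g + 1 - (n + 1 : ℕ)) = 0 := by
    intro n
    simp only [hd, vpShift_sub]
    have h1 : ¬ (g < g + 1 - (n + 1 : ℕ)) := by push_cast; omega
    have h2 : ¬ (g < m) := not_lt.2 hm
    rw [if_neg h1, if_neg h2]
    simp
  simp only [hzero, tsum_zero, add_zero]
  -- above the gap: the pair bound
  have hge : ∀ n : ℕ, vpW lam μ ((g - m).toNat + 1 + n) ≤ d (g + 1 + n) := by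
    intro n
    simp only [hd, vpShift_sub]
    have h1 : g < g + 1 + n := by omega
    have h2 : ¬ (g < m) := not_lt.2 hm
    have h3 : g + 1 + (n : ℤ) ≠ m := by omega
    rw [if_pos h1, if_neg h2, if_neg h3, if_neg h3, sub_zero]
    have := hpair m (g + 1 + n) hm h1
    have e : (g + 1 + (n : ℤ) - m).toNat = (g - m).toNat + 1 + n := by omega
    rwa [e] at this
  refine Summable.tsum_le_tsum hge (vp_summable_W lam μ _) ?_
  exact hds.comp_injective (i := fun n : ℕ => g + 1 + (n : ℤ)) fun a b h => by
    simpa using h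

/-- **Orientation two.** For `m > g`, the change of the registry energy of layer `m` is the ray sum over
the layers `m' = g − n` below the gap (symmetry `Φ(−H, −δ) = Φ(H, δ)`), bounded below by the weights.
[folklore] -/
theorem vp_ray_above (b : ℝ) (s : ℤ → ℤ) (ζ : ℤ → ℝ) (g : ℤ) (θ : ℝ) (lam : ℕ → ℝ) (μ : ℝ)
    (hsum : ∀ m : ℤ, Summable fun m' : ℤ => if m' = m then (0 : ℝ) else
      layerInteraction lennardJones b (ζ m' - ζ m) (haggLabel s m' - haggLabel s m) 1)
    (hsum' : ∀ m : ℤ, Summable fun m' : ℤ => if m' = m then (0 : ℝ) else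
      layerInteraction lennardJones b (vpShift ζ g θ m' - vpShift ζ g θ m) (haggLabel s m' - haggLabel s m) 1)
    (hpair : ∀ m m' : ℤ, m ≤ g → g < m' → vpW lam μ (m' - m).toNat ≤
      layerInteraction lennardJones b (ζ m' - ζ m) (haggLabel s m' - haggLabel s m) 1 -
        layerInteraction lennardJones b (ζ m' - ζ m + θ) (haggLabel s m' - haggLabel s m) 1)
    (m : ℤ) (hm : g < m) :
    ∑' n : ℕ, vpW lam μ ((m - g - 1).toNat + 1 + n) ≤ vpT b s ζ m - vpT b s (vpShift ζ g θ) m := by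
  unfold vpT
  rw [← (hsum m).tsum_sub (hsum' m)]
  set d : ℤ → ℝ := fun m' => (if m' = m then (0 : ℝ) else
      layerInteraction lennardJones b (ζ m' - ζ m) (haggLabel s m' - haggLabel s m) 1) -
    (if m' = m then (0 : ℝ) else
      layerInteraction lennardJones b (vpShift ζ g θ m' - vpShift ζ g θ m) (haggLabel s m' - haggLabel s m) 1)
    with hd
  have hds : Summable d := (hsum m).sub (hsum' m)
  rw [LayeredHull.clo_tsum_int_split d (g + 1) hds]
  -- above the gap nothing changes
  have hzero : ∀ n : ℕ, d (g + 1 + n) = 0 := by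
    intro n
    simp only [hd, vpShift_sub]
    by_cases h3 : g + 1 + (n : ℤ) = m
    · rw [if_pos h3, if_pos h3, sub_zero]
    · have h1 : g < g + 1 + n := by omega
      rw [if_neg h3, if_neg h3, if_pos h1, if_pos hm]
      simp
  simp only [hzero, tsum_zero, zero_add]
  -- below the gap: the pair bound, after the symmetry of the layer interaction
  have hge : ∀ n : ℕ, vpW lam μ ((m - g - 1).toNat + 1 + n) ≤ d (g + 1 - (n + 1 : ℕ)) := by
    intro n
    simp only [hd, vpShift_sub]
    have h1 : ¬ (g < g + 1 - (n + 1 : ℕ)) := by push_cast; omega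
    have h3 : g + 1 - ((n + 1 : ℕ) : ℤ) ≠ m := by push_cast; omega
    rw [if_neg h1, if_pos hm, if_neg h3, if_neg h3, zero_sub]
    have key := hpair (g + 1 - (n + 1 : ℕ)) m (by push_cast; omega) hm
    have e : (m - (g + 1 - ((n + 1 : ℕ) : ℤ))).toNat = (m - g - 1).toNat + 1 + n := by push_cast; omega
    rw [e] at key
    have s1 : layerInteraction lennardJones b (ζ (g + 1 - (n + 1 : ℕ)) - ζ m)
        (haggLabel s (g + 1 - (n + 1 : ℕ)) - haggLabel s m) 1 =
        layerInteraction lennardJones b (ζ m - ζ (g + 1 - (n + 1 : ℕ)))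
        (haggLabel s m - haggLabel s (g + 1 - (n + 1 : ℕ))) 1 := by
      rw [← LayeredHull.clo_layerInteraction_symm, neg_sub, neg_sub]
    have s2 : layerInteraction lennardJones b (ζ (g + 1 - (n + 1 : ℕ)) - ζ m + -θ)
        (haggLabel s (g + 1 - (n + 1 : ℕ)) - haggLabel s m) 1 =
        layerInteraction lennardJones b (ζ m - ζ (g + 1 - (n + 1 : ℕ)) + θ)
        (haggLabel s m - haggLabel s (g + 1 - (n + 1 : ℕ))) 1 := by
      rw [← LayeredHull.clo_layerInteraction_symm, neg_sub]
      congr 1; ring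
    rw [s1, s2]
    exact key
  refine Summable.tsum_le_tsum hge (vp_summable_W lam μ _) ?_
  exact hds.comp_injective (i := fun n : ℕ => g + 1 - ((n + 1 : ℕ) : ℤ)) fun a b h => by
    have : ((a + 1 : ℕ) : ℤ) = ((b + 1 : ℕ) : ℤ) := by
      have := h; simp only [sub_right_inj] at this; exact this
    omega

/-! ## The window sum -/

/-- Reindexing the layers below the gap: `[m₁, g] = {g − i : i < g + 1 − m₁}`. [folklore] -/
theorem vp_sum_Ico_below (f : ℤ → ℝ) (m₁ g : ℤ) (h : m₁ ≤ g + 1) :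
    ∑ m ∈ Finset.Ico m₁ (g + 1), f m = ∑ i ∈ Finset.range (g + 1 - m₁).toNat, f (g - i) := by
  have himg : Finset.Ico m₁ (g + 1) = (Finset.range (g + 1 - m₁).toNat).image fun i : ℕ => g - i := by
    ext m
    simp only [Finset.mem_Ico, Finset.mem_image, Finset.mem_range]
    constructor
    · rintro ⟨h1, h2⟩
      exact ⟨(g - m).toNat, by omega, by omega⟩
    · rintro ⟨i, hi, rfl⟩
      omega
  rw [himg, Finset.sum_image fun i _ j _ hij => by simpa using hij]

/-- Reindexing the layers above the gap: `[g+1, M) = {g + 1 + i : i < M − g − 1}`. [folklore] -/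
theorem vp_sum_Ico_above (f : ℤ → ℝ) (g M : ℤ) (h : g + 1 ≤ M) :
    ∑ m ∈ Finset.Ico (g + 1) M, f m = ∑ i ∈ Finset.range (M - g - 1).toNat, f (g + 1 + i) := by
  have := LayeredHull.clo_sum_Ico_eq_sum_range f (g + 1) (M - g - 1).toNat
  rw [show g + 1 + (((M - g - 1).toNat : ℕ) : ℤ) = M by omega] at this
  exact this

/-- **The window bookkeeping of a single shifted gap.** With the registry energies `T_m`, the shifted
profile and the pair weights as above: if every straddling pair at distance `k` changes by at least `w k`,
then on every window `[m₁, m₁+n)` with `m₁ + 4 ≤ g` and `g + 6 ≤ m₁ + n`,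
`2 Σ_{k<6} k λ_k − 2 μ Z ≤ Σ_{m ∈ [m₁, m₁+n)} (T_m(ζ) − T_m(ζ'))`, `Z = (6/625 + 1/375)/4`. [folklore] -/
theorem vp_single_gap (b : ℝ) (s : ℤ → ℤ) (ζ : ℤ → ℝ) (g : ℤ) (θ : ℝ) (lam : ℕ → ℝ) (μ : ℝ)
    (hμ : 0 ≤ μ)
    (hsum : ∀ m : ℤ, Summable fun m' : ℤ => if m' = m then (0 : ℝ) else
      layerInteraction lennardJones b (ζ m' - ζ m) (haggLabel s m' - haggLabel s m) 1)
    (hsum' : ∀ m : ℤ, Summable fun m' : ℤ => if m' = m then (0 : ℝ) else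
      layerInteraction lennardJones b (vpShift ζ g θ m' - vpShift ζ g θ m) (haggLabel s m' - haggLabel s m) 1)
    (hpair : ∀ m m' : ℤ, m ≤ g → g < m' → vpW lam μ (m' - m).toNat ≤
      layerInteraction lennardJones b (ζ m' - ζ m) (haggLabel s m' - haggLabel s m) 1 -
        layerInteraction lennardJones b (ζ m' - ζ m + θ) (haggLabel s m' - haggLabel s m) 1)
    (m₁ : ℤ) (n : ℕ) (hg1 : m₁ + 4 ≤ g) (hg2 : g + 6 ≤ m₁ + n) :
    2 * (∑ k ∈ Finset.range 6, (k : ℝ) * lam k) - 2 * (μ * (1 / 4 * (6 / 625 + 1 / 375))) ≤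
      ∑ m ∈ Finset.Ico m₁ (m₁ + n), (vpT b s ζ m - vpT b s (vpShift ζ g θ) m) := by
  have hsplit : Finset.Ico m₁ (m₁ + n) = Finset.Ico m₁ (g + 1) ∪ Finset.Ico (g + 1) (m₁ + n) :=
    (Finset.Ico_union_Ico_eq_Ico (by omega) (by omega)).symm
  rw [hsplit, Finset.sum_union (Finset.Ico_disjoint_Ico_consecutive _ _ _),
    vp_sum_Ico_below _ m₁ g (by omega), vp_sum_Ico_above _ g (m₁ + n) (by omega)]
  have hb := vp_arith lam hμ (g + 1 - m₁).toNat (by omega)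
  have ha := vp_arith lam hμ (m₁ + n - g - 1).toNat (by omega)
  have h1 : ∑ i ∈ Finset.range (g + 1 - m₁).toNat, ∑' k : ℕ, vpW lam μ (i + 1 + k) ≤
      ∑ i ∈ Finset.range (g + 1 - m₁).toNat, (vpT b s ζ (g - i) - vpT b s (vpShift ζ g θ) (g - i)) := by
    refine Finset.sum_le_sum fun i _ => ?_
    have := vp_ray_below b s ζ g θ lam μ hsum hsum' hpair (g - i) (by omega)
    rwa [show (g - (g - (i : ℤ))).toNat = i by omega] at this
  have h2 : ∑ i ∈ Finset.range (m₁ + n - g - 1).toNat, ∑' k : ℕ, vpW lam μ (i + 1 + k) ≤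
      ∑ i ∈ Finset.range (m₁ + n - g - 1).toNat,
        (vpT b s ζ (g + 1 + i) - vpT b s (vpShift ζ g θ) (g + 1 + i)) := by
    refine Finset.sum_le_sum fun i _ => ?_
    have := vp_ray_above b s ζ g θ lam μ hsum hsum' hpair (g + 1 + i) (by omega)
    rwa [show (g + 1 + (i : ℤ) - g - 1).toNat = i by omega] at this
  linarith

end Summit.AtomisticToContinuum.Crystallization.Theorems.CleanHull

end
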